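import Literature.RepresentationTheory.HeisenbergGroup.SchrodingerConjugateTorusRamifiedTestVector
import Literature.NumberTheory.GelbartRogawski1991.FinLocalSplittingsSplitSphericalCoeffDarboux
import Literature.NumberTheory.Automorphic.Liu2021.Def411WeilCarriersSurvivalNonsplit
import Literature.NumberTheory.Automorphic.UnitaryGroupNonsplitTorus
import HarnessLib

/-!
# [Li1992, Thm 2.1 (27)] — the local factor at a split RAMIFIED place: a test vector with non-zero local integral

J.-S. Li, *Non-vanishing theorems for the cohomology of certain arithmetic quotients*, J. reine angew. Math. **428** (1992),
Thm 2.1 (27) p. 184 and §5 p. 206: at the finitely many bad places the local integrals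
`I_v(Φ_v, Φ_v) = ∫_{U(J₁)(F_v)} ⟨ω_v(h·1)Φ_v, Φ_v⟩ conj χ_v(h) dh` of the Rallis inner product formula are made non-zero by a CHOICE of
test vector.  This file does it at a place `v` SPLIT in `E` (`w ∣ v`, `c w ≠ w`) with NO unramifiedness assumption on `ψ_v`, `T`, `χ_v`
or the splitting `s_v`:

* **`exists_testVector_localFactor_ne_zero_of_split`** — there is `Φ ∈ 𝒮(F_vᴺ)` whose local integrand is the constant `μ'ᴺ((𝔭^n)ᴺ) ≠ 0`
  times the indicator of a compact open subgroup-neighbourhood `K_n = {h | h_w ∈ 1 + 𝔭_w^n}` of `1`; hence the local integral is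
  integrable and equals `dh(K_n) · μ'ᴺ((𝔭^n)ᴺ) ≠ 0`.

Route: the centre acts through the conjugated scalar Levi torus `ι_v(h·1) = γ_w⁻¹ m(t_h·1) γ_w` (★ `iota_localCenter_eq`); the ramified test
vectors `Φ_n = Γ⁻¹ 1_{1+(𝔭^n)ᴺ}` of ★ `SchrodingerConjugateTorusRamifiedTestVector` have coefficient supported in `K_n` and are
`K_n`-eigen with the uniqueness scalar `c_h`; `c_h = 1` and `χ_v(h) = 1` on `K_n` for `n ≫ 0` by SMOOTHNESS of `ω_v` (`𝓢.smooth`), the open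
kernel of the continuous character `χ_v` (profinite `U(J₁)(𝒪_v)`, `ℂ^×` has no small subgroups) and `U(J₁)(F_v) ≃ₜ E_w^×`
(★ `localPiSplitEquiv`): §1 supplies this topology of the split torus.

KERNEL only: theorems, no definition, no named fact, no `sorry`.  Cell hodgecm-mathlib, FLOOR 0, programme P4 (F4), crux item H413
(`--supports stmt-HodgeConjecture-24833`).  HC_CM is proved only modulo the printed citations until rung 0 closes; nothing here is a claim about them.

## References
* [Li1992] J.-S. Li, J. reine angew. Math. 428 (1992) 177–217 — Thm 2.1 (27) p. 184; §5 p. 206.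
* [BernsteinZelevinsky1976] I. N. Bernstein, A. V. Zelevinsky, Russian Math. Surveys 31:3 (1976), §2.1 (smooth vectors, open kernels).
* [PlatonovRapinchuk1994] V. Platonov, A. Rapinchuk, *Algebraic Groups and Number Theory* (1994), §5.1, §6.2.
* [MoeglinVignerasWaldspurger1987] C. Mœglin, M.-F. Vignéras, J.-L. Waldspurger, LNM 1291 (1987), Chap. 2 II.1, II.6.
-/

set_option autoImplicit false

noncomputable section

open NumberField IsDedekindDomain MeasureTheory Filter Set Topology
open scoped Matrix NNReal ComplexConjugate
open Literature.RepresentationTheory Literature.RepresentationTheory.HeisenbergGroup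
open Literature.NumberTheory.Automorphic
open Literature.NumberTheory.Automorphic.UnitaryGroup
open Literature.NumberTheory.GaloisRepresentations.IsNonarchimedeanLocalField

/-! ## §1 Topology of the split torus `U(J₁)(F_v) ≃ₜ E_w^×` -/

namespace Literature.NumberTheory.Automorphic.UnitaryGroup

variable {F E : Type} [Field F] [NumberField F] [Field E] [NumberField E] [Algebra F E]
variable (c : E ≃ₐ[F] E) (J₁ : Matrix (Fin 1) (Fin 1) E) {v : HeightOneSpectrum (𝓞 F)}

/-- `J₁` with `J₁ 0 0 ≠ 0` is invertible at every place. [folklore] -/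
private theorem isUnit_placeForm_one (hJ₁ : J₁ 0 0 ≠ 0) (w : HeightOneSpectrum (𝓞 E)) : IsUnit (placeForm J₁ w) :=
  isUnit_placeForm J₁ ((Matrix.isUnit_iff_isUnit_det J₁).2 (by rw [Matrix.det_fin_one]; exact isUnit_iff_ne_zero.2 hJ₁)) w

/-- **at a split place `z ↦ (z_w)₀₀` is injective on `U(J₁)(F_v)`** (`U(J₁)(F_v) ≃ GL₁(E_w)`, ★ `localPiSplitEquiv`).
[cite: PlatonovRapinchuk1994, §6.2] -/
theorem entry_injective_of_split [Algebra.IsQuadraticExtension F E] (hc : c ≠ 1) (hJ₁c : (J₁.map c)ᵀ = J₁) (hJ₁ : J₁ 0 0 ≠ 0)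
    (w : PlacesOver E v) (hw : c • w.1 ≠ w.1) :
    Function.Injective fun z : localPi E c 1 J₁ v =>
      (((z : LocalGLPi E 1 v) w : GL (Fin 1) (w.1.adicCompletion E)) : Matrix (Fin 1) (Fin 1) (w.1.adicCompletion E)) 0 0 := by
  intro z z' h
  apply (localPiSplitEquiv c J₁ hc hJ₁c w hw (isUnit_placeForm_one J₁ hJ₁ w.1)).injective
  rw [localPiSplitEquiv_apply, localPiSplitEquiv_apply]
  refine Units.ext (Matrix.ext fun i j => ?_)
  obtain rfl : i = 0 := Subsingleton.elim _ _
  obtain rfl : j = 0 := Subsingleton.elim _ _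
  exact h

/-- **`U(J₁)(F_v)` is totally disconnected at a split place** (continuous injection into the totally disconnected `E_w`).
[cite: PlatonovRapinchuk1994, §6.2] -/
theorem totallyDisconnectedSpace_localPi_one_of_split [Algebra.IsQuadraticExtension F E] (hc : c ≠ 1)
    (hJ₁c : (J₁.map c)ᵀ = J₁) (hJ₁ : J₁ 0 0 ≠ 0) (w : PlacesOver E v) (hw : c • w.1 ≠ w.1) :
    TotallyDisconnectedSpace (localPi E c 1 J₁ v) :=
  ⟨fun s _ hs => Set.subsingleton_of_image (entry_injective_of_split c J₁ hc hJ₁c hJ₁ w hw) s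
    ((hs.image _ (continuous_entry c J₁ w).continuousOn).subsingleton)⟩

/-- **a continuous character of `U(J₁)(F_v)` is trivial on a neighbourhood of `1`** at a split place: its restriction to the
profinite `U(J₁)(𝒪_v)` has open kernel (`ℂ^×` has no small subgroups). [cite: BernsteinZelevinsky1976, §2.1] -/
theorem exists_isOpen_forall_eq_one_of_split [Algebra.IsQuadraticExtension F E] (hc : c ≠ 1) (hJ₁c : (J₁.map c)ᵀ = J₁)
    (hJ₁ : J₁ 0 0 ≠ 0) (w : PlacesOver E v) (hw : c • w.1 ≠ w.1) (χ : localPi E c 1 J₁ v →* ℂˣ)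
    (hχc : Continuous fun z => ((χ z : ℂˣ) : ℂ)) :
    ∃ U : Set (localPi E c 1 J₁ v), IsOpen U ∧ (1 : localPi E c 1 J₁ v) ∈ U ∧ ∀ z ∈ U, χ z = 1 := by
  haveI := totallyDisconnectedSpace_localPi_one_of_split c J₁ hc hJ₁c hJ₁ w hw
  haveI : CompactSpace (localInt E c 1 J₁ v) := isCompact_iff_compactSpace.1 (isCompact_localInt E c 1 J₁ v)
  have hχ : Continuous χ := by
    refine Units.continuous_iff.2 ⟨hχc, ?_⟩
    simp only [Units.val_inv_eq_inv_val]
    exact hχc.inv₀ fun z => (χ z).ne_zero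
  set χK : localInt E c 1 J₁ v →* ℂˣ := χ.comp (localInt E c 1 J₁ v).subtype with hχK
  have hK : IsOpen (χK.ker : Set (localInt E c 1 J₁ v)) :=
    Literature.GroupTheory.PiCharacter.isOpen_ker_units_complex χK (hχ.comp continuous_subtype_val)
  refine ⟨Subtype.val '' (χK.ker : Set (localInt E c 1 J₁ v)), (isOpen_localInt E c 1 J₁ v).isOpenMap_subtype_val _ hK,
    ⟨1, (MonoidHom.mem_ker).2 (map_one χK), rfl⟩, ?_⟩
  rintro _ ⟨k, hk, rfl⟩
  exact (MonoidHom.mem_ker).1 hk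

/-- **the congruence neighbourhoods `{z | z_w ∈ 1 + 𝔭_w^n}` are a basis at `1` of `U(J₁)(F_v)`** at a split place
(`U(J₁)(F_v) ≃ₜ GL₁(E_w)`, ★ `localPiSplitEquiv`, and `E_w^× ↪ E_w` is an embedding). [cite: PlatonovRapinchuk1994, §6.2] -/
theorem exists_forall_entry_mem_imp_mem_of_split [Algebra.IsQuadraticExtension F E] (hc : c ≠ 1) (hJ₁c : (J₁.map c)ᵀ = J₁)
    (hJ₁ : J₁ 0 0 ≠ 0) (w : PlacesOver E v) (hw : c • w.1 ≠ w.1) {S : Set (localPi E c 1 J₁ v)}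
    (hS : S ∈ 𝓝 (1 : localPi E c 1 J₁ v)) :
    ∃ n : ℤ, 1 ≤ n ∧ ∀ z : localPi E c 1 J₁ v,
      (((z : LocalGLPi E 1 v) w : GL (Fin 1) (w.1.adicCompletion E)) : Matrix (Fin 1) (Fin 1) (w.1.adicCompletion E)) 0 0 - 1 ∈
        primePowBall (w.1.adicCompletion E) n → z ∈ S := by
  set e := localPiSplitEquiv c J₁ hc hJ₁c w hw (isUnit_placeForm_one J₁ hJ₁ w.1) with he
  -- the scalar embedding `E_w^× → GL₁(E_w) ≃ U(J₁)(F_v)`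
  have hsc : Continuous (algebraMap (w.1.adicCompletion E) (Matrix (Fin 1) (Fin 1) (w.1.adicCompletion E))) := by
    rw [Algebra.algebraMap_eq_smul_one']
    exact continuous_id.smul continuous_const
  set g : (w.1.adicCompletion E)ˣ → localPi E c 1 J₁ v := fun u =>
    e.symm (Units.map (algebraMap (w.1.adicCompletion E) (Matrix (Fin 1) (Fin 1) (w.1.adicCompletion E))).toMonoidHom u) with hg
  have hgc : Continuous g := e.symm.continuous.comp (Units.continuous_map hsc)
  have hg1 : g 1 = 1 := by simp only [hg, map_one]
  have hS' : g ⁻¹' S ∈ 𝓝 (1 : (w.1.adicCompletion E)ˣ) := hgc.continuousAt.preimage_mem_nhds (by rwa [hg1])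
  rw [Units.isEmbedding_val₀.nhds_eq_comap, Filter.mem_comap] at hS'
  obtain ⟨V, hV, hVS⟩ := hS'
  rw [Units.val_one] at hV
  have hV' : (fun x : w.1.adicCompletion E => x + 1) ⁻¹' V ∈ 𝓝 (0 : w.1.adicCompletion E) :=
    (continuous_id.add continuous_const).continuousAt.preimage_mem_nhds (by simpa only [Pi.add_apply, id_eq, zero_add] using hV)
  obtain ⟨n, hn⟩ := exists_primePowBall_subset_of_mem_nhds_zero hV'
  refine ⟨max 1 (n : ℤ), le_max_left _ _, fun z hz => ?_⟩
  have hz' : (((z : LocalGLPi E 1 v) w : GL (Fin 1) (w.1.adicCompletion E)) : Matrix (Fin 1) (Fin 1) (w.1.adicCompletion E)) 0 0 - 1 ∈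
      primePowBall (w.1.adicCompletion E) (n : ℤ) := primePowBall_antitone (le_max_right _ _) hz
  have hy0 := ne_zero_of_sub_one_mem_primePowBall (le_max_left 1 (n : ℤ)) hz
  have hmem : Units.mk0 _ hy0 ∈ g ⁻¹' S := by
    apply hVS
    rw [Set.mem_preimage, Units.val_mk0]
    have := hn hz'
    rwa [Set.mem_preimage, sub_add_cancel] at this
  have hu : Units.map (algebraMap (w.1.adicCompletion E) (Matrix (Fin 1) (Fin 1) (w.1.adicCompletion E))).toMonoidHom
      (Units.mk0 _ hy0) = e z := by
    rw [he, localPiSplitEquiv_apply]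
    refine Units.ext (Matrix.ext fun i j => ?_)
    obtain rfl : i = 0 := Subsingleton.elim _ _
    obtain rfl : j = 0 := Subsingleton.elim _ _
    rw [Units.coe_map, RingHom.toMonoidHom_eq_coe, MonoidHom.coe_coe, Units.val_mk0, Algebra.algebraMap_eq_smul_one,
      Matrix.smul_apply, Matrix.one_apply_eq, smul_eq_mul, mul_one]
  have hgz : g (Units.mk0 _ hy0) = z := by
    rw [hg]
    simp only
    rw [hu, ContinuousMulEquiv.symm_apply_apply]
  rw [← hgz]
  exact hmem

end Literature.NumberTheory.Automorphic.UnitaryGroup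

/-! ## §2 The test vector at a split ramified place -/

namespace Literature.NumberTheory.GelbartRogawski1991.UnitaryDualPair.LocalSplitting.FinLocalSplittings

variable {F : Type} [Field F] [NumberField F] {E : Type} [Field E] [NumberField E] [Algebra F E]
  [Algebra.IsQuadraticExtension F E] {c : E ≃ₐ[F] E} {N : ℕ} {δ : E} {hcδ : c δ = -δ} {hδ : δ ≠ 0} {d : F}
  {hd : δ * δ = algebraMap F E d} {T : Matrix (Fin N) (Fin N) F} {hT : T.IsSymm}
  {J : Matrix (Fin N) (Fin N) E} {hJ : J = T.map (algebraMap F E)}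
  (𝓢 : FinLocalSplittings F E c N hcδ hδ hd T hT hJ) (J₁ : Matrix (Fin 1) (Fin 1) E) (hJ₁ : J₁ 0 0 ≠ 0)
  (hTd : IsUnit T.det) (v : HeightOneSpectrum (𝓞 F))

set_option maxHeartbeats 400000 in
include hTd in
/-- **[Li1992 (27)] AT A SPLIT RAMIFIED PLACE: A TEST VECTOR WITH NON-ZERO LOCAL INTEGRAL.**  Let `v` be a place with `w ∣ v` split in `E`
(`c w ≠ w`), `N ≥ 1`, `χ_v : U(J₁)(F_v) →* ℂ^×` continuous, `dh` a measure on `U(J₁)(F_v)` finite on compacts and charging open sets, and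
`ω_v = toRep ∘ s_v` the local Weil representation of a restricted family of local splittings (smooth; NO unramifiedness at `v`).  Then there
are `Φ ∈ 𝒮(F_vᴺ)`, an open `K ∋ 1` and a constant `C ≠ 0` with local integrand `h ↦ ⟨ω_v(h·1)Φ, Φ⟩ conj χ_v(h) = C · 1_K(h)`; the local
integral is integrable and `∫_{U(J₁)(F_v)} ⟨ω_v(h·1)Φ, Φ⟩ conj χ_v(h) dh = dh(K) · C ≠ 0`.
[cite: Li1992, Thm 2.1 (27) p. 184; §5 p. 206] [cite: MoeglinVignerasWaldspurger1987, Chap. 2 II.1, II.6] [cite: BernsteinZelevinsky1976, §2.1] -/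
theorem exists_testVector_localFactor_ne_zero_of_split [NeZero N] (hJ₁c : (J₁.map c)ᵀ = J₁) (w : PlacesOver E v) (hw : c • w.1 ≠ w.1)
    [MeasurableSpace (localPi E c 1 J₁ v)] [BorelSpace (localPi E c 1 J₁ v)] (dh : Measure (localPi E c 1 J₁ v))
    [IsFiniteMeasureOnCompacts dh] [dh.IsOpenPosMeasure]
    [MeasurableSpace (v.adicCompletion F)] [BorelSpace (v.adicCompletion F)] (μ' : Measure (v.adicCompletion F)) [μ'.IsAddHaarMeasure]
    (χv : localPi E c 1 J₁ v →* ℂˣ) (hχc : Continuous fun z => ((χv z : ℂˣ) : ℂ)) :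
    ∃ (Φ : SchwartzBruhat (Fin N → v.adicCompletion F)) (K : Set (localPi E c 1 J₁ v)) (C : ℂ),
      IsOpen K ∧ (1 : localPi E c 1 J₁ v) ∈ K ∧ dh K < ⊤ ∧ C ≠ 0 ∧
      (fun h : localPi E c 1 J₁ v => (∫ x, ((𝓢.omegaLoc v (localCenter E c N J J₁ hJ₁ v h) Φ :
            SchwartzBruhat (Fin N → v.adicCompletion F)) : (Fin N → v.adicCompletion F) → ℂ) x *
          conj (((Φ : SchwartzBruhat (Fin N → v.adicCompletion F)) : (Fin N → v.adicCompletion F) → ℂ) x)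
          ∂(Measure.pi fun _ : Fin N => μ')) * conj ((χv h : ℂˣ) : ℂ)) = K.indicator (fun _ => C) ∧
      Integrable (fun h : localPi E c 1 J₁ v => (∫ x, ((𝓢.omegaLoc v (localCenter E c N J J₁ hJ₁ v h) Φ :
            SchwartzBruhat (Fin N → v.adicCompletion F)) : (Fin N → v.adicCompletion F) → ℂ) x *
          conj (((Φ : SchwartzBruhat (Fin N → v.adicCompletion F)) : (Fin N → v.adicCompletion F) → ℂ) x)
          ∂(Measure.pi fun _ : Fin N => μ')) * conj ((χv h : ℂˣ) : ℂ)) dh ∧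
      (∫ h, (∫ x, ((𝓢.omegaLoc v (localCenter E c N J J₁ hJ₁ v h) Φ :
            SchwartzBruhat (Fin N → v.adicCompletion F)) : (Fin N → v.adicCompletion F) → ℂ) x *
          conj (((Φ : SchwartzBruhat (Fin N → v.adicCompletion F)) : (Fin N → v.adicCompletion F) → ℂ) x)
          ∂(Measure.pi fun _ : Fin N => μ')) * conj ((χv h : ℂˣ) : ℂ) ∂dh = (dh.real K : ℂ) * C) ∧
      (∫ h, (∫ x, ((𝓢.omegaLoc v (localCenter E c N J J₁ hJ₁ v h) Φ :
            SchwartzBruhat (Fin N → v.adicCompletion F)) : (Fin N → v.adicCompletion F) → ℂ) x *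
          conj (((Φ : SchwartzBruhat (Fin N → v.adicCompletion F)) : (Fin N → v.adicCompletion F) → ℂ) x)
          ∂(Measure.pi fun _ : Fin N => μ')) * conj ((χv h : ℂˣ) : ℂ) ∂dh) ≠ 0 := by
  haveI : Nonempty (Fin N) := ⟨0⟩
  haveI : SecondCountableTopology (v.adicCompletion F) := secondCountableTopology_localField _
  have hc : c ≠ 1 := by
    rintro rfl
    exact hδ (self_eq_neg.1 (by simpa only [AlgEquiv.one_apply] using hcδ))
  set ν : Measure (Fin N → v.adicCompletion F) := Measure.pi fun _ : Fin N => μ' with hν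
  -- notation: the `w`-entry and the `w`-coordinate `t`
  set ent : localPi E c 1 J₁ v → w.1.adicCompletion E := fun z =>
    (((z : LocalGLPi E 1 v) w : GL (Fin 1) (w.1.adicCompletion E)) : Matrix (Fin 1) (Fin 1) (w.1.adicCompletion E)) 0 0 with hent
  set t : localPi E c 1 J₁ v → v.adicCompletion F := fun z => splitCoord F E c hcδ hδ v w fun w' =>
    (((z : LocalGLPi E 1 v) w' : GL (Fin 1) (w'.1.adicCompletion E)) : Matrix (Fin 1) (Fin 1) (w'.1.adicCompletion E)) 0 0 with ht_def
  have htoPlace : ∀ z, toPlace v w (t z) = ent z := fun z => toPlace_splitCoord F E c hcδ hδ hd v w hw _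
  have hent0 : ∀ z, ent z ≠ 0 := fun z => by
    have hdet : ((Matrix.GeneralLinearGroup.det ((z : LocalGLPi E 1 v) w) : (w.1.adicCompletion E)ˣ) : w.1.adicCompletion E) =
        ent z := by rw [Matrix.GeneralLinearGroup.val_det_apply, Matrix.det_fin_one]
    rw [← hdet]; exact Units.ne_zero _
  have ht0 : ∀ z, t z ≠ 0 := fun z h0 => hent0 z (by rw [← htoPlace, h0, map_zero])
  -- the dictionary `t z - 1 ∈ 𝔭_v^n ↔ z_w - 1 ∈ 𝔭_w^n`
  have hdict : ∀ (n : ℤ) (z : localPi E c 1 J₁ v),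
      t z - 1 ∈ primePowBall (v.adicCompletion F) n ↔ ent z - 1 ∈ primePowBall (w.1.adicCompletion E) n := fun n z => by
    rw [mem_primePowBall_adicCompletion_iff, mem_primePowBall_adicCompletion_iff, ← valued_toPlace_of_split F E c v w hw,
      map_sub, map_one, htoPlace]
  -- the scalar Levi elements `a z = t z · 1`
  set a : localPi E c 1 J₁ v → GL (Fin N) (v.adicCompletion F) := fun z =>
    Units.map (algebraMap (v.adicCompletion F) (Matrix (Fin N) (Fin N) (v.adicCompletion F))).toMonoidHom
      (Units.mk0 (t z) (ht0 z)) with ha_def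
  have ha : ∀ z, (a z : Matrix (Fin N) (Fin N) (v.adicCompletion F)) = t z • 1 := fun z => by
    change algebraMap (v.adicCompletion F) (Matrix (Fin N) (Fin N) (v.adicCompletion F)) (t z) = _
    exact Algebra.algebraMap_eq_smul_one (t z)
  -- the implementers `φ z = s_v(z · 1_N)` of `γ_w⁻¹ m(a z) γ_w`
  have hbT : ∀ y : Fin N → v.adicCompletion F, Continuous fun u : Fin N → v.adicCompletion F =>
      localPairing F N T v u y := fun y => by
    simp only [Matrix.toLinearMap₂'_apply', dotProduct]
    exact continuous_finsetSum _ fun i _ => (continuous_apply i).mul continuous_const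
  set γ := splitDarboux F E c N hcδ hδ hd T v hT w hw with hγ
  set φ : localPi E c 1 J₁ v → (SchwartzBruhat (Fin N → v.adicCompletion F) ≃ₗ[ℂ] SchwartzBruhat (Fin N → v.adicCompletion F)) :=
    fun z => ((𝓢.s v (localCenter E c N J J₁ hJ₁ v z) : LocalMp F N T v) : LocalSp F N T v ×
      (SchwartzBruhat (Fin N → v.adicCompletion F) ≃ₗ[ℂ] SchwartzBruhat (Fin N → v.adicCompletion F))).2 with hφ_def
  have hωφ : ∀ z Φ, 𝓢.omegaLoc v (localCenter E c N J J₁ hJ₁ v z) Φ = φ z Φ := fun z Φ => 𝓢.omegaLoc_apply v _ Φ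
  have hφ : ∀ z, Implements (localSchrodinger F N T v) (ofSymplectic _
      (γ⁻¹ * SymplecticMatrix.transportSp (localGram F N T v) (isUnit_det_localGram F N T hTd v)
        (SymplecticMatrix.levi (a z)) * γ)) (φ z) := fun z => by
    rw [hγ, ← iota_localCenter_eq F E c N hcδ hδ hd T hJ v hT hTd (isUnit_det_localGram F N T hTd v) w hw hJ₁ z (a z) (ha z)]
    exact 𝓢.implements_snd_s v _
  -- the ramified test vectors
  obtain ⟨Φ, cz, hΦ⟩ := exists_ramifiedTestVector (localGram F N T v) (isUnit_det_localGram F N T hTd v)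
    (isLocallyConstant_of_isContinuousNontrivial (isContinuousNontrivial_adeleAddCharAt F v)) hbT μ'
    (isContinuousNontrivial_adeleAddCharAt F v) γ φ t ht0 a ha hφ
  -- `Φ 1 ≠ 0`
  have hpos : ∀ n : ℤ, (ν.real (piPrimePowBall (v.adicCompletion F) (Fin N) n) : ℂ) ≠ 0 := fun n =>
    Complex.ofReal_ne_zero.2 (measureReal_piPrimePowBall_pos ν n).ne'
  have hΦ1 : Φ 1 ≠ 0 := fun h0 => by
    have h := (hΦ 1 le_rfl).1
    rw [h0] at h
    simp only [ZeroMemClass.coe_zero, Pi.zero_apply, zero_mul, integral_zero] at h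
    exact hpos 1 h.symm
  -- the neighbourhood `S` of `1`: stabiliser of `Φ 1`, kernel of `χ_v`, integral points
  have hstab : IsOpen {z : localPi E c 1 J₁ v | 𝓢.omegaLoc v (localCenter E c N J J₁ hJ₁ v z) (Φ 1) = Φ 1} :=
    (𝓢.smooth v (Φ 1)).preimage (continuous_localCenter E c N J J₁ hJ₁ v)
  obtain ⟨U, hUo, hU1, hU⟩ := exists_isOpen_forall_eq_one_of_split c J₁ hc hJ₁c hJ₁ w hw χv hχc
  set S : Set (localPi E c 1 J₁ v) := {z | 𝓢.omegaLoc v (localCenter E c N J J₁ hJ₁ v z) (Φ 1) = Φ 1} ∩ U ∩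
    (localInt E c 1 J₁ v : Set (localPi E c 1 J₁ v)) with hS_def
  have hSo : IsOpen S := (hstab.inter hUo).inter (isOpen_localInt E c 1 J₁ v)
  have hS1 : (1 : localPi E c 1 J₁ v) ∈ S := ⟨⟨by simp only [Set.mem_setOf_eq, map_one, Module.End.one_apply], hU1⟩, Subgroup.one_mem _⟩
  obtain ⟨n, hn1, hn⟩ := exists_forall_entry_mem_imp_mem_of_split c J₁ hc hJ₁c hJ₁ w hw (hSo.mem_nhds hS1)
  obtain ⟨hnorm, hsupp, heig⟩ := hΦ n hn1
  -- the set `K = K_n` and the constant `C`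
  set K : Set (localPi E c 1 J₁ v) := {z | t z - 1 ∈ primePowBall (v.adicCompletion F) n} with hK_def
  have hKent : K = ent ⁻¹' ((fun y : w.1.adicCompletion E => y - 1) ⁻¹' primePowBall (w.1.adicCompletion E) n) :=
    Set.ext fun z => hdict n z
  have hKo : IsOpen K := by
    rw [hKent]
    exact ((isOpen_primePowBall _).preimage (continuous_id.sub continuous_const)).preimage (continuous_entry c J₁ w)
  have hK1 : (1 : localPi E c 1 J₁ v) ∈ K := by
    rw [hKent, Set.mem_preimage, Set.mem_preimage, hent]
    simp only [OneMemClass.coe_one, Pi.one_apply, Units.val_one, Matrix.one_apply_eq, sub_self]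
    exact zero_mem_primePowBall _
  have hKS : K ⊆ S := fun z hz => hn z ((hdict n z).1 hz)
  have hKtop : dh K < ⊤ :=
    lt_of_le_of_lt (measure_mono fun z hz => (hKS hz).2) (isCompact_localInt E c 1 J₁ v).measure_lt_top
  -- on `K`: the uniqueness scalar is `1`, `χ_v = 1`
  have hcz : ∀ z ∈ K, cz z = 1 := fun z hz => by
    have h1 : t z - 1 ∈ primePowBall (v.adicCompletion F) 1 := primePowBall_antitone hn1 hz
    have he := (hΦ 1 le_rfl).2.2 z h1
    have hfix : φ z (Φ 1) = Φ 1 := by rw [← hωφ]; exact (hKS hz).1.1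
    rw [hfix] at he
    exact smul_left_injective ℂ hΦ1 (show cz z • Φ 1 = (1 : ℂ) • Φ 1 by rw [one_smul]; exact he.symm)
  set C : ℂ := (ν.real (piPrimePowBall (v.adicCompletion F) (Fin N) n) : ℂ) with hC
  have hind : (fun h : localPi E c 1 J₁ v => (∫ x, ((𝓢.omegaLoc v (localCenter E c N J J₁ hJ₁ v h) (Φ n) :
            SchwartzBruhat (Fin N → v.adicCompletion F)) : (Fin N → v.adicCompletion F) → ℂ) x *
          conj (((Φ n : SchwartzBruhat (Fin N → v.adicCompletion F)) : (Fin N → v.adicCompletion F) → ℂ) x) ∂ν) *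
        conj ((χv h : ℂˣ) : ℂ)) = K.indicator (fun _ => C) := by
    funext h
    by_cases hh : h ∈ K
    · rw [Set.indicator_of_mem hh, hωφ, heig h hh, hcz h hh, one_smul, hnorm, hU h (hKS hh).1.2, Units.val_one, map_one,
        mul_one]
    · rw [Set.indicator_of_notMem hh, hωφ, hsupp h hh, zero_mul]
  have hint : ∫ h, K.indicator (fun _ => C) h ∂dh = (dh.real K : ℂ) * C := by
    rw [integral_indicator_const C hKo.measurableSet, Complex.real_smul]
  refine ⟨Φ n, K, C, hKo, hK1, hKtop, hpos n, hind, ?_, ?_, ?_⟩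
  · rw [hind]
    have hI : IntegrableOn (fun _ : localPi E c 1 J₁ v => C) K dh := integrableOn_const (hs := hKtop.ne)
    exact hI.integrable_indicator hKo.measurableSet
  · rw [hind]; exact hint
  · rw [hind, hint]
    exact mul_ne_zero (Complex.ofReal_ne_zero.2 (ENNReal.toReal_pos ((hKo.measure_pos dh ⟨1, hK1⟩).ne') hKtop.ne).ne') (hpos n)

end Literature.NumberTheory.GelbartRogawski1991.UnitaryDualPair.LocalSplitting.FinLocalSplittings

end
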